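import Summits.CriticalPhenomena.PercolationContinuityZ3.Theorems.PercNearOneGluingNoHeavyLowerTailKNUniversalGluingCoefficients
import HarnessLib

/-!
# `NoHeavyLowerTail` (stmt-CriticalPhenomena-4575) — universal gluing coefficients in Kozma–Nitzan's printed generality (cluster properties monotone
# along NONEMPTY vertex sets)

Support file (`--supports stmt-CriticalPhenomena-4575`), prover `prim-ineq-gen-7` (gen 7).  No definitions, no named facts, no sorries; standard axioms.
Corollary of `UniversalGluing.universal_coefficients` (this seat, same session): Kozma–Nitzan's requirement (1) (§5.1, p. 31) constrains `f(v,ω) = F(C_ω(v))` only along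
nonempty sets (clusters are nonempty), and such an `F` agrees on nonempty sets with a function monotone on all sets (`KNPreFKG.monotoneOnNonempty_extension`).
[cite: KozmaNitzan2024, §5.1 (p. 31), Conj. 4 and Question 5 (p. 32)]
-/

noncomputable section

namespace Summit.CriticalPhenomena.PercolationContinuityZ3.Theorems

open MeasureTheory Set Literature.Probability.LatticeModels Literature.Probability.Percolation
open scoped Classical

namespace UniversalGluing

variable {n : ℕ}

/-- **Universal coefficients in Kozma–Nitzan's printed generality**: for every finite weighted graph, `A ≠ ∅`, `0`, ONE probability vector `c` on `A` has
`Σ_{a∈A} c_a · E[F(C_a); 0 ↔ A] ≤ E[F(C_0); 0 ↔ A]` for every `F` monotone along NONEMPTY vertex sets. [cite: KozmaNitzan2024, §5.1 (p. 31), Conj. 4 and Question 5 (p. 32)] -/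
theorem universal_coefficients_clusterProperty (w : Sym2 (Fin n) → unitInterval) (A : Finset (Fin n)) (o : Fin n) (hA : A.Nonempty) :
    ∃ c : Fin n → ℝ, (∀ a, 0 ≤ c a) ∧ ∑ a ∈ A, c a = 1 ∧
      ∀ F : Set (Fin n) → ℝ, (∀ S T : Set (Fin n), S.Nonempty → S ⊆ T → F S ≤ F T) →
        ∑ a ∈ A, c a * ∫ ω in ⋃ a' ∈ A, openConn o a', F (openCluster ω a) ∂(prodBernoulli w) ≤
          ∫ ω in ⋃ a' ∈ A, openConn o a', F (openCluster ω o) ∂(prodBernoulli w) := by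
  obtain ⟨c, hc0, hc1, hcF⟩ := universal_coefficients w A o hA
  refine ⟨c, hc0, hc1, fun F hF => ?_⟩
  obtain ⟨F', hF'mono, hF'eq⟩ := KNPreFKG.monotoneOnNonempty_extension o F hF
  have hx : ∀ (x : Fin n) (ω : BondConfig (Fin n)), F (openCluster ω x) = F' (openCluster ω x) :=
    fun x ω => (hF'eq _ ⟨x, mem_openCluster_self ω x⟩).symm
  have h := hcF F' hF'mono
  simp_rw [← hx] at h
  exact h

end UniversalGluing

end Summit.CriticalPhenomena.PercolationContinuityZ3.Theorems

end
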